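import Summits.QuantumFields.YangMills.Theorems.ColdStartUniversalityLatticeLangevinDeltaMethod
import Mathlib.Analysis.InnerProductSpace.Dual
import HarnessLib

/-!
# Route `ColdStartUniversality` (fixed-cut-off SZZ dynamics, sampler package): the delta method with an EXPLICIT Gaussian limit —
# `√T(h(X̄_T) − h(m)) ⇒ N(0, ∇h(m)ᵀ S ∇h(m))`

Helper file (seat `ym-line-csu-p1`, g35; `--supports stmt-QuantumFields-24809`).  The limit `h'(Y)`, `Y ~ N(0,S)`, of the delta method
(file `…DeltaMethod`) is identified: a continuous linear functional of a multivariate Gaussian vector is a real Gaussian,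
`ℓ_* N(0,S) = N(0, aᵀSa)` with `aᵢ = ℓ(eᵢ)` (`map_clm_multivariateGaussian`, from Mathlib's `IsGaussian` API; `hasLaw_clm_multivariateGaussian`),
whence for every measurable `h : ℝ^ι → ℝ` differentiable at the mean vector `m` and EVERY strong solution of the SU(2) SZZ dynamics from a
deterministic start

  `√T_n (h(X̄_(T_n)) − h(m))  ⇒  N(0, aᵀ S a)`,  `aᵢ = h'(eᵢ) = ∂ᵢh(m)`,  along every `T_n → ∞`   (★★★ `deltaMethod_timeAverage_clt_gaussian`),

`S` the Green–Kubo covariance matrix of the observables (file 99b).  THEOREMS ONLY, no definition, no sorry; [folklore].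
HONEST FRAMING: fixed cut-off; `S` depends on `L, β'`; `UniformColdStartMixing` (24809) is NOT restated; no crux, rung or summit statement is
proved; the Yang–Mills mass gap is NOT proved.
-/

set_option autoImplicit false

noncomputable section

namespace Summit.QuantumFields.YangMills.Theorems.ColdStartUniversality

open MeasureTheory ProbabilityTheory Filter Topology Set Matrix
open scoped NNReal ENNReal BigOperators InnerProductSpace
open Literature Literature.Probability.Process Literature.MathematicalPhysics.QuantumFieldTheory
open Literature.MathematicalPhysics.QuantumLattice (fundamentalRep fundamentalLatticeRep continuous_fundamentalRep)

/-! ## §1. Linear functionals of a multivariate Gaussian -/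

/-- A continuous linear functional of a centred multivariate Gaussian is a centred real Gaussian with variance `aᵀSa`, `aᵢ = ℓ(eᵢ)`. [folklore] -/
theorem map_clm_multivariateGaussian {ι : Type} [Fintype ι] [DecidableEq ι] {S : Matrix ι ι ℝ} (hS : S.PosSemidef)
    (ℓ : EuclideanSpace ℝ ι →L[ℝ] ℝ) :
    (multivariateGaussian 0 S).map ℓ =
      gaussianReal 0 ((fun i => ℓ (EuclideanSpace.single i (1 : ℝ))) ⬝ᵥ S *ᵥ (fun i => ℓ (EuclideanSpace.single i (1 : ℝ)))).toNNReal := by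
  set aE : EuclideanSpace ℝ ι := (InnerProductSpace.toDual ℝ (EuclideanSpace ℝ ι)).symm ℓ with haE
  have hℓ : (ℓ : EuclideanSpace ℝ ι → ℝ) = fun u => ⟪aE, u⟫_ℝ := funext fun u => InnerProductSpace.toDual_symm_apply.symm
  have haEi : (fun i => ℓ (EuclideanSpace.single i (1 : ℝ))) = aE.ofLp := by
    funext i
    have h1 : ⟪aE, EuclideanSpace.single i (1 : ℝ)⟫_ℝ = ℓ (EuclideanSpace.single i (1 : ℝ)) := InnerProductSpace.toDual_symm_apply
    rw [EuclideanSpace.inner_single_right, one_mul, conj_trivial] at h1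
    exact h1.symm
  rw [IsGaussian.map_eq_gaussianReal ℓ, ContinuousLinearMap.integral_comp_id_comm IsGaussian.integrable_id, integral_id_multivariateGaussian,
    map_zero, haEi]
  congr 2
  change variance (ℓ : EuclideanSpace ℝ ι → ℝ) (multivariateGaussian 0 S) = _
  rw [hℓ, ← covarianceBilin_self IsGaussian.memLp_two_id, covarianceBilin_multivariateGaussian hS]

/-- Law version: if `Y ~ N(0,S)` then `ℓ(Y) ~ N(0, aᵀSa)` with `aᵢ = ℓ(eᵢ)`. [folklore] -/
theorem hasLaw_clm_multivariateGaussian {ι : Type} [Fintype ι] [DecidableEq ι] {S : Matrix ι ι ℝ} (hS : S.PosSemidef)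
    (ℓ : EuclideanSpace ℝ ι →L[ℝ] ℝ) {Ω' : Type*} {mΩ' : MeasurableSpace Ω'} {P' : Measure Ω'} {Y : Ω' → EuclideanSpace ℝ ι}
    (hY : HasLaw Y (multivariateGaussian 0 S) P') :
    HasLaw (fun ω => ℓ (Y ω))
      (gaussianReal 0 ((fun i => ℓ (EuclideanSpace.single i (1 : ℝ))) ⬝ᵥ S *ᵥ (fun i => ℓ (EuclideanSpace.single i (1 : ℝ)))).toNNReal) P' := by
  have hℓlaw : HasLaw (ℓ : EuclideanSpace ℝ ι → ℝ)
      (gaussianReal 0 ((fun i => ℓ (EuclideanSpace.single i (1 : ℝ))) ⬝ᵥ S *ᵥ (fun i => ℓ (EuclideanSpace.single i (1 : ℝ)))).toNNReal)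
      (multivariateGaussian 0 S) :=
    ⟨ℓ.continuous.measurable.aemeasurable, map_clm_multivariateGaussian hS ℓ⟩
  exact hℓlaw.comp hY

/-! ## §2. The delta method with an explicit Gaussian limit -/

variable {L : ℕ} [NeZero L]

/-- ★★★ **Delta method, explicit Gaussian limit.**  With `X̄_T = (T⁻¹∫₀^T Gᵢ(U_r)dr)ᵢ`, `m = (μ_(β')Gᵢ)ᵢ`, the Green–Kubo matrix `S` and
`aᵢ = h'(eᵢ)`: for every measurable `h : ℝ^ι → ℝ` differentiable at `m`, every strong solution from a deterministic start and every
`T_n → ∞` (`T_n > 0`), `√T_n (h(X̄_(T_n)) − h(m)) → Z` in distribution for every `Z ~ gaussianReal 0 (aᵀSa)` (fixed cut-off). [folklore] -/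
theorem deltaMethod_timeAverage_clt_gaussian (L : ℕ) [NeZero L] (β' : ℝ)
    (κ : ℝ≥0 → Kernel (GaugeConfig 3 L (Matrix.specialUnitaryGroup (Fin 2) ℂ))
      (GaugeConfig 3 L (Matrix.specialUnitaryGroup (Fin 2) ℂ))) [∀ t, IsMarkovKernel (κ t)]
    (hreal : ∀ (t : ℝ≥0) (x : GaugeConfig 3 L (Matrix.specialUnitaryGroup (Fin 2) ℂ))
        (Ω : Type) [MeasurableSpace Ω] (P : Measure Ω) [IsProbabilityMeasure P]
        (W : ℝ≥0 → Ω → (Edge 3 L × NoiseIdx 2 → ℝ)) (hW : IsFlatBrownian W P)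
        (U : ℝ≥0 → Ω → GaugeConfig 3 L (Matrix.specialUnitaryGroup (Fin 2) ℂ)),
        (∀ ω, U 0 ω = x) →
        (latticeLangevinDynamics (fundamentalLatticeRep 2) β').IsSolution (fundamentalRep (Fin 2))
          hW.natFiltration P W U →
        κ t x = P.map (U t))
    (x₀ : GaugeConfig 3 L (Matrix.specialUnitaryGroup (Fin 2) ℂ))
    {Ω : Type} [MeasurableSpace Ω] {P : Measure Ω} [IsProbabilityMeasure P]
    {W : ℝ≥0 → Ω → (Edge 3 L × NoiseIdx 2 → ℝ)} (hW : IsFlatBrownian W P)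
    {U : ℝ≥0 → Ω → GaugeConfig 3 L (Matrix.specialUnitaryGroup (Fin 2) ℂ)} (hU0 : ∀ ω, U 0 ω = x₀)
    (hU : (latticeLangevinDynamics (fundamentalLatticeRep 2) β').IsSolution (fundamentalRep (Fin 2)) hW.natFiltration P W U)
    {ι : Type} [Fintype ι] [DecidableEq ι]
    {G : ι → GaugeConfig 3 L (Matrix.specialUnitaryGroup (Fin 2) ℂ) → ℝ} (hGc : ∀ i, Continuous (G i)) (hG1 : ∀ i z, |G i z| ≤ 1)
    {S : Matrix ι ι ℝ}
    (hS : S = fun i j => ∫ t in Ioi (0 : ℝ),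
      (∫ y, ((G i y - ∫ z, G i z ∂(wilsonMeasure (d := 3) (L := L) (fundamentalRep (Fin 2)) β')) *
          (∫ z, (G j z - ∫ z', G j z' ∂(wilsonMeasure (d := 3) (L := L) (fundamentalRep (Fin 2)) β')) ∂(κ t.toNNReal y)) +
        (G j y - ∫ z, G j z ∂(wilsonMeasure (d := 3) (L := L) (fundamentalRep (Fin 2)) β')) *
          (∫ z, (G i z - ∫ z', G i z' ∂(wilsonMeasure (d := 3) (L := L) (fundamentalRep (Fin 2)) β')) ∂(κ t.toNNReal y)))
        ∂(wilsonMeasure (d := 3) (L := L) (fundamentalRep (Fin 2)) β')))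
    {h : EuclideanSpace ℝ ι → ℝ} {h' : EuclideanSpace ℝ ι →L[ℝ] ℝ} (hhm : Measurable h)
    (hh : HasFDerivAt h h' (WithLp.toLp 2 fun i => ∫ z, G i z ∂(wilsonMeasure (d := 3) (L := L) (fundamentalRep (Fin 2)) β')))
    (Ω' : Type) [MeasurableSpace Ω'] (P' : Measure Ω') [IsProbabilityMeasure P'] (Z : Ω' → ℝ)
    (hZ : HasLaw Z (gaussianReal 0 ((fun i => h' (EuclideanSpace.single i (1 : ℝ))) ⬝ᵥ
      S *ᵥ (fun i => h' (EuclideanSpace.single i (1 : ℝ)))).toNNReal) P')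
    (Tn : ℕ → ℝ) (hTn : Tendsto Tn atTop atTop) (hTpos : ∀ n, 0 < Tn n) :
    TendstoInDistribution (fun (n : ℕ) ω => Real.sqrt (Tn n) *
        (h (WithLp.toLp 2 fun i => (Tn n)⁻¹ * ∫ r in Ioc (0 : ℝ) (Tn n), G i (U r.toNNReal ω)) -
          h (WithLp.toLp 2 fun i => ∫ z, G i z ∂(wilsonMeasure (d := 3) (L := L) (fundamentalRep (Fin 2)) β'))))
      atTop Z (fun _ => P) P' := by
  classical
  have hPSD : S.PosSemidef := (multivariate_timeAverage_clt L β' κ hreal x₀ hW hU0 hU hGc hG1 hS).1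
  -- the delta method with the canonical Gaussian vector `id` on `(ℝ^ι, N(0,S))`
  have hD := deltaMethod_timeAverage_clt L β' κ hreal x₀ hW hU0 hU hGc hG1 hS hhm hh (EuclideanSpace ℝ ι) (multivariateGaussian 0 S) id
    HasLaw.id Tn hTn hTpos
  have hlaw := (hasLaw_clm_multivariateGaussian hPSD h' (HasLaw.id (μ := multivariateGaussian 0 S))).map_eq
  refine ⟨hD.forall_aemeasurable, hZ.aemeasurable, ?_⟩
  convert hD.tendsto using 2
  exact Subtype.ext (by simp only; rw [hZ.map_eq]; exact hlaw.symm)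

end Summit.QuantumFields.YangMills.Theorems.ColdStartUniversality

end
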